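import Summits.ResolutionOfSingularities.ResolutionOfSingularities.Theorems.PurelyInseparableDim4ChartDictionary
import Summits.ResolutionOfSingularities.ResolutionOfSingularities.Theorems.Rescue.RR154GenericGoingUp
import HarnessLib

/-!
# Purely inseparable four-folds `z^p + F(x₁, …, x₄)`: the FIBRE-DEGREE BOUND of the chart dictionary
# (brick S3-glob at depth 2, part A1 — pure polynomial algebra; cell `res-dim4-pi`, typ-2 g4)

[OURS · counted 0] (D-0157 DOOR 2; director-resolution DR-157-C; desk WORD #97 (c) «S3-glob signature»;
frame `PIDim4.TerminationImpliesOrderReduction`, S3 (c)). The S3-glob question at depth 2 (typ-2 g3 memo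
`S3c-COORD-HISTORY.md`): after a blowing up of `𝔸⁵` along `V(z, x_S)`, is the CLOSURE in `W₁` of the
re-centred `x_j`-chart image of a next coordinate centre `V(z, x_{S'})` — which ESCAPES the chart when
`S ∖ {j} ⊄ S'` (`…ChartCentreEscape`) — still a regular admissible centre? The mechanism behind the
answer is a degree bound on the monomials produced by the chart dictionary, proved here at the level of
exponents, for ANY index type `σ`, ANY commutative ring of coefficients (the `p`-th root step over a
field of characteristic `p`). Nothing here is a statement about resolution of singularities in
dimension ≥ 4 / characteristic `p` (NOT proved anywhere in this programme).

Write `ψ = coordBlowupSubst K S j` (`xᵢ ↦ x_j xᵢ` for `i ∈ S ∖ j`), and call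
`Σ_{i ∈ S ∖ j} dᵢ ≤ q + d_j` the **fibre bound with excess `q`** for an exponent `d` (the variables
`xᵢ`, `i ∈ S ∖ j`, are the fibre coordinates of the `x_j`-chart). PROVED (no `sorry`, no new axiom):

* §1 `fibre_le_of_mem_support_chartTransform` — under permissibility `q ≤ ord_{(x_S)} F`, every monomial
  of `CentreBlowup.chartTransform q S j F` satisfies the fibre bound with excess `q` (the new
  `x_j`-exponent is `Σ_{i∈S} dᵢ − q ≥ Σ_{i ∈ S∖j} dᵢ − q`).
* §2 `aeval_const_monomial`, `exists_of_mem_support_aeval_const`, `fibre_le_of_mem_support_aeval_const` —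
  substituting CONSTANTS `cₖ` for the variables `xₖ`, `k ∈ T` (with `c_j = 0` if `j ∈ T`) preserves the
  fibre bound (each monomial `x^e` becomes `(∏_{k∈T} cₖ^{eₖ}) · x^{e|_{∉T}}`).
* §3 `nsmul_mem_support_pow_char`, `fibre_le_of_pow_char_eq` — over a field of characteristic `p`: if
  `g^p` satisfies the fibre bound with excess `p` then `g` satisfies it with excess `1`
  (`coeff_{p·e} (g^p) = (coeff_e g)^p`, the tree's `Rescue.coeff_smul_pow_char`).
* §4 `coordBlowupSubst_monomial_lift`, `exists_coordBlowupSubst_eq_X_mul` — **polynomiality**: if `g`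
  satisfies the fibre bound with excess `1`, there is a polynomial `H` with `ψ(H) = x_j · g`
  (`H = x_j · g(x_{S∖j}/x_j, …)` has no denominators), explicitly
  `H = Σ_e coeff_e g · x^{e + (1 + e_j − Σ_{i∈S∖j} eᵢ − e_j)·𝟙_j}`.

How these are used (sequel `…ChartClosureIdeal`): the chart reading `Θ(ψ(z^p + F)) = x_j^p (z^p + F₁)`
and the permissibility of `S'` for `F₁` give `ḡ^p = −F̄'` for the cleaning graph `ḡ` restricted to the
next centre, whence `ḡ` has fibre bound `1` and the chart centre is the strict transform of the regular
GRAPH `z = H(x)` over a linear space. bears_on: LADDER-RESOLUTION:D157-DOOR2 (res-dim4-pi). Supports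
stmt-ResolutionOfSingularities-16155 (helper, S3-glob A1).
-/

-- every declaration of this summit lives under `Summit.ResolutionOfSingularities.ResolutionOfSingularities`
-- (summit = problem), which the duplicate-namespace linter flags; house convention (cf. the Target file).
set_option linter.dupNamespace false

noncomputable section

open MvPolynomial Finset

open scoped BigOperators

namespace Summit.ResolutionOfSingularities.ResolutionOfSingularities.Theorems.PIDim4

open Literature.AlgebraicGeometry.Resolution

namespace ChartDictionary

/-! ## §1 The chart transform satisfies the fibre bound with excess `q` -/

section ChartTransform

variable {σ : Type*} [DecidableEq σ] {K : Type*} [CommRing K]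

/-- A monomial of the chart transform comes from a monomial of `F`. -/
theorem exists_chartExponent_eq_of_mem_support (q : ℕ) (S : Finset σ) (j : σ) (F : MvPolynomial σ K)
    {d : σ →₀ ℕ} (hd : d ∈ (CentreBlowup.chartTransform q S j F).support) :
    ∃ e ∈ F.support, CentreBlowup.chartExponent q S j e = d := by
  classical
  rw [MvPolynomial.mem_support_iff, CentreBlowup.chartTransform, coeff_sum] at hd
  obtain ⟨e, he, hne⟩ := Finset.exists_ne_zero_of_sum_ne_zero hd
  rw [coeff_monomial] at hne
  by_cases hed : CentreBlowup.chartExponent q S j e = d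
  · exact ⟨e, he, hed⟩
  · rw [if_neg hed] at hne
    exact absurd rfl hne

/-- **The fibre bound for the chart transform.** Under permissibility (`q ≤ ord_{(x_S)} F`), every
monomial `x^d` of `chartTransform q S j F` has `Σ_{i ∈ S∖j} dᵢ ≤ q + d_j`: a monomial `x^e` of `F` becomes
`x^d` with `dᵢ = eᵢ` (`i ≠ j`) and `d_j = Σ_{i∈S} eᵢ − q ≥ Σ_{i∈S∖j} eᵢ − q`. -/
theorem fibre_le_of_mem_support_chartTransform (q : ℕ) (S : Finset σ) (j : σ) (F : MvPolynomial σ K)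
    (hperm : (q : ℕ∞) ≤ CentreBlowup.ordAlong S F) {d : σ →₀ ℕ}
    (hd : d ∈ (CentreBlowup.chartTransform q S j F).support) :
    ∑ i ∈ S.erase j, d i ≤ q + d j := by
  obtain ⟨e, he, rfl⟩ := exists_chartExponent_eq_of_mem_support q S j F hd
  have hq : q ≤ CentreBlowup.degIn S e := by
    have h := CentreBlowup.ordAlong_le_of_mem_support (S := S) he
    exact_mod_cast hperm.trans h
  have h1 : ∑ i ∈ S.erase j, CentreBlowup.chartExponent q S j e i = ∑ i ∈ S.erase j, e i :=
    Finset.sum_congr rfl fun i hi => CentreBlowup.chartExponent_apply_of_ne q S (Finset.ne_of_mem_erase hi) e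
  have h2 : ∑ i ∈ S.erase j, e i ≤ CentreBlowup.degIn S e :=
    Finset.sum_le_sum_of_subset (Finset.erase_subset j S)
  rw [h1, CentreBlowup.chartExponent_apply_self]
  omega

end ChartTransform

/-! ## §2 Substituting constants for some variables preserves the fibre bound -/

section Const

variable {σ : Type*} [DecidableEq σ] {K : Type*} [CommRing K]

/-- The monomials `xᵢ^{eᵢ}`, `i ∉ T`, multiply to the monomial `x^{e|_{∉T}}`. -/
theorem prod_filter_X_pow (T : Finset σ) (e : σ →₀ ℕ) :
    ∏ i ∈ e.support.filter (fun i => i ∉ T), (X i : MvPolynomial σ K) ^ e i =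
      monomial (e.filter (fun i => i ∉ T)) 1 := by
  rw [← MvPolynomial.prod_X_pow_eq_monomial, Finsupp.support_filter]
  refine Finset.prod_congr rfl fun i hi => ?_
  rw [Finsupp.filter_apply_pos (fun i => i ∉ T) e (Finset.mem_filter.mp hi).2]

/-- **Substituting constants in a monomial**: with `xₖ ↦ cₖ` for `k ∈ T` and `xᵢ ↦ xᵢ` otherwise,
`c · x^e ↦ (c · ∏_{k ∈ T} cₖ^{eₖ}) · x^{e|_{∉T}}`. -/
theorem aeval_const_monomial (T : Finset σ) (c : σ → K) (e : σ →₀ ℕ) (a : K) :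
    aeval (fun i => if i ∈ T then C (c i) else (X i : MvPolynomial σ K)) (monomial e a) =
      monomial (e.filter (fun i => i ∉ T)) (a * ∏ k ∈ e.support.filter (fun k => k ∈ T), c k ^ e k) := by
  rw [aeval_monomial, Finsupp.prod, ← Finset.prod_filter_mul_prod_filter_not e.support (fun k => k ∈ T)]
  have h1 : ∏ k ∈ e.support.filter (fun k => k ∈ T),
      (if k ∈ T then C (c k) else (X k : MvPolynomial σ K)) ^ e k =
      C (∏ k ∈ e.support.filter (fun k => k ∈ T), c k ^ e k) := by
    rw [map_prod]
    exact Finset.prod_congr rfl fun k hk => by rw [if_pos (Finset.mem_filter.mp hk).2, map_pow]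
  have h2 : ∏ k ∈ e.support.filter (fun k => ¬ k ∈ T),
      (if k ∈ T then C (c k) else (X k : MvPolynomial σ K)) ^ e k =
      monomial (e.filter (fun i => i ∉ T)) 1 := by
    rw [← prod_filter_X_pow T e]
    exact Finset.prod_congr rfl fun k hk => by rw [if_neg (Finset.mem_filter.mp hk).2]
  rw [h1, h2, C_mul_monomial, mul_one, MvPolynomial.algebraMap_eq, C_mul_monomial]

/-- **Support of a constant substitution**: a monomial `x^d` of the result comes from a monomial `x^e` of
`P` with `d = e|_{∉T}` and `eₖ = 0` for every `k ∈ T` with `cₖ = 0`. -/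
theorem exists_of_mem_support_aeval_const (T : Finset σ) (c : σ → K) (P : MvPolynomial σ K)
    {d : σ →₀ ℕ} (hd : d ∈ (aeval (fun i => if i ∈ T then C (c i) else (X i : MvPolynomial σ K)) P).support) :
    ∃ e ∈ P.support, e.filter (fun i => i ∉ T) = d ∧ ∀ k ∈ T, c k = 0 → e k = 0 := by
  classical
  rw [MvPolynomial.mem_support_iff] at hd
  conv at hd => rw [P.as_sum, map_sum, coeff_sum]
  obtain ⟨e, he, hne⟩ := Finset.exists_ne_zero_of_sum_ne_zero hd
  rw [aeval_const_monomial, coeff_monomial] at hne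
  by_cases hed : e.filter (fun i => i ∉ T) = d
  · refine ⟨e, he, hed, fun k hk hck => ?_⟩
    rw [if_pos hed] at hne
    by_contra hek
    apply hne
    rw [Finset.prod_eq_zero (i := k) (Finset.mem_filter.mpr ⟨Finsupp.mem_support_iff.mpr hek, hk⟩)
      (by rw [hck, zero_pow hek]), mul_zero]
  · rw [if_neg hed] at hne
    exact absurd rfl hne

/-- **Constant substitution preserves the fibre bound** (with `c_j = 0` if the chart variable `x_j` is
substituted): if every monomial of `P` has `Σ_{i ∈ S∖j} dᵢ ≤ q + d_j`, so does every monomial of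
`P(xₖ ↦ cₖ, k ∈ T)`. -/
theorem fibre_le_of_mem_support_aeval_const (q : ℕ) (S T : Finset σ) (j : σ) (c : σ → K)
    (hcj : j ∈ T → c j = 0) (P : MvPolynomial σ K) (hP : ∀ d ∈ P.support, ∑ i ∈ S.erase j, d i ≤ q + d j)
    {d : σ →₀ ℕ} (hd : d ∈ (aeval (fun i => if i ∈ T then C (c i) else (X i : MvPolynomial σ K)) P).support) :
    ∑ i ∈ S.erase j, d i ≤ q + d j := by
  obtain ⟨e, he, rfl, hzero⟩ := exists_of_mem_support_aeval_const T c P hd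
  have h1 : ∑ i ∈ S.erase j, (e.filter (fun i => i ∉ T)) i ≤ ∑ i ∈ S.erase j, e i :=
    Finset.sum_le_sum fun i _ => by
      rw [Finsupp.filter_apply]
      split_ifs <;> omega
  have h2 : (e.filter (fun i => i ∉ T)) j = e j := by
    rw [Finsupp.filter_apply]
    by_cases hj : j ∈ T
    · rw [if_neg (not_not.mpr hj), hzero j hj (hcj hj)]
    · rw [if_pos hj]
  rw [h2]
  exact h1.trans (hP e he)

end Const

/-! ## §3 The `p`-th root step (characteristic `p`) -/

section PthRoot

variable {σ : Type*} {K : Type*} [Field K] (p : ℕ) [hp : Fact p.Prime] [CharP K p]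

/-- A monomial `x^e` of `g` gives the monomial `x^{p·e}` of `g^p`. -/
theorem nsmul_mem_support_pow_char {g : MvPolynomial σ K} {e : σ →₀ ℕ} (he : e ∈ g.support) :
    p • e ∈ (g ^ p).support := by
  rw [MvPolynomial.mem_support_iff] at he ⊢
  rw [Rescue.coeff_smul_pow_char p g e]
  exact pow_ne_zero p he

/-- **The `p`-th root step.** If `g^p = G` and every monomial of `G` has `Σ_{i ∈ S∖j} dᵢ ≤ p + d_j`, then
every monomial of `g` has `Σ_{i ∈ S∖j} eᵢ ≤ 1 + e_j` (divide the bound for `x^{p·e}` by `p`). -/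
theorem fibre_le_of_pow_char_eq [DecidableEq σ] (S : Finset σ) (j : σ) {g G : MvPolynomial σ K}
    (hgG : g ^ p = G)
    (hG : ∀ d ∈ G.support, ∑ i ∈ S.erase j, d i ≤ p + d j) {e : σ →₀ ℕ} (he : e ∈ g.support) :
    ∑ i ∈ S.erase j, e i ≤ 1 + e j := by
  have h := hG (p • e) (hgG ▸ nsmul_mem_support_pow_char p he)
  simp only [Finsupp.coe_smul, Pi.smul_apply, smul_eq_mul] at h
  rw [← Finset.mul_sum] at h
  have h' : p * ∑ i ∈ S.erase j, e i ≤ p * (1 + e j) := by rw [mul_add, mul_one]; exact h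
  exact Nat.le_of_mul_le_mul_left h' hp.out.pos

end PthRoot

/-! ## §4 Polynomiality: the fibre bound with excess `1` is exactly `x_j · g ∈ range ψ` -/

section Lift

variable {σ : Type*} [DecidableEq σ] {K : Type*} [CommRing K]

/-- **The lifted monomial.** For `Σ_{i ∈ S∖j} eᵢ ≤ 1 + e_j`, the monomial `x^{e*}`,
`e* = e` off `j`, `e*_j = 1 + e_j − Σ_{i∈S∖j} eᵢ`, satisfies `ψ(c · x^{e*}) = x_j · c · x^e`. -/
theorem coordBlowupSubst_monomial_lift (S : Finset σ) (j : σ) {e : σ →₀ ℕ}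
    (he : ∑ i ∈ S.erase j, e i ≤ 1 + e j) (c : K) :
    coordBlowupSubst K (S : Set σ) j (monomial (e.update j (1 + e j - ∑ i ∈ S.erase j, e i)) c) =
      X j * monomial e c := by
  have h1 : ∑ k ∈ S.erase j, (e.update j (1 + e j - ∑ k ∈ S.erase j, e k)) k = ∑ k ∈ S.erase j, e k :=
    Finset.sum_congr rfl fun k hk => by rw [Finsupp.update_apply, if_neg (Finset.ne_of_mem_erase hk)]
  have hexp : Finsupp.single j (∑ k ∈ S.erase j, (e.update j (1 + e j - ∑ k ∈ S.erase j, e k)) k) +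
      e.update j (1 + e j - ∑ k ∈ S.erase j, e k) = Finsupp.single j 1 + e := by
    ext i
    by_cases hij : i = j
    · subst hij
      rw [Finsupp.add_apply, Finsupp.single_eq_same, h1, Finsupp.update_apply, if_pos rfl, Finsupp.add_apply,
        Finsupp.single_eq_same]
      omega
    · rw [Finsupp.add_apply, Finsupp.single_eq_of_ne hij, Finsupp.update_apply, if_neg hij,
        Finsupp.add_apply, Finsupp.single_eq_of_ne hij]
  rw [coordBlowupSubst_monomial, hexp, X, monomial_mul, one_mul]

/-- **Polynomiality.** If every monomial of `g` satisfies the fibre bound with excess `1`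
(`Σ_{i ∈ S∖j} eᵢ ≤ 1 + e_j`), then `x_j · g = ψ(H)` for the polynomial `H = Σ_e coeff_e g · x^{e*}`, i.e.
`x_j · g(x_{S∖j}/x_j, x_j, …)` has no denominators. -/
theorem exists_coordBlowupSubst_eq_X_mul (S : Finset σ) (j : σ) (g : MvPolynomial σ K)
    (hg : ∀ e ∈ g.support, ∑ i ∈ S.erase j, e i ≤ 1 + e j) :
    ∃ H : MvPolynomial σ K, coordBlowupSubst K (S : Set σ) j H = X j * g := by
  refine ⟨∑ e ∈ g.support, monomial (e.update j (1 + e j - ∑ i ∈ S.erase j, e i)) (coeff e g), ?_⟩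
  rw [map_sum, Finset.sum_congr rfl fun e he => coordBlowupSubst_monomial_lift S j (hg e he) (coeff e g),
    ← Finset.mul_sum]
  exact congrArg _ g.as_sum.symm

end Lift

end ChartDictionary

end Summit.ResolutionOfSingularities.ResolutionOfSingularities.Theorems.PIDim4

end
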